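import Mathlib
import HarnessLib
import Summits.AnomalousDissipation.AnomalousDissipation.Theses.PointSink
import Literature.Analysis.FluidPDE.SteadyNSLiouville
import Literature.Analysis.FluidPDE.SteadyNSLiouvilleL3AnnulusProofs
import Literature.Analysis.FluidPDE.SteadyLiouvilleNineHalvesProofs
import Summits.AnomalousDissipation.AnomalousDissipation.Theorems.PointSinkSolitonTransplantStubTestedRescaledNS
import Summits.AnomalousDissipation.AnomalousDissipation.Theorems.PointSinkSolitonTransplantStubShellDefectScaling
import Summits.AnomalousDissipation.AnomalousDissipation.Theorems.PointSinkSolitonTransplantStubLocalL2Convergence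
import Summits.AnomalousDissipation.AnomalousDissipation.Theorems.PointSinkSolitonTransplantStubFarFieldWeakEuler

/-!
# Necessary conditions on the node class of `ConeDesingularisation` / `CascadeSoliton`
# (stmt-AnomalousDissipation-19034 ≡ 19036, route PointSink; line `Sketch`, lead cycle 2)

Since `PointFluxCone` is a theorem, the crux `ConeDesingularisation` is the node `CascadeSoliton`
(`Negative.coneDesingularisation_iff_cascadeSoliton`, p167258): a smooth steady unforced unit-viscosity
Navier–Stokes solution `(Q, P)` on `ℝ³` with finite non-zero Dirichlet integral `D = ∫|∇Q|²` whose
shell-`L²` far field is a non-trivial discretely self-similar field `V` of degree `−2/3`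
(`(λ^k)^{-5/3} ∫_{λ^k<|x|<λ^{k+1}} |Q − V|² → 0`). This file records, kernel-checked and
UNCONDITIONALLY, the two sharpest necessary conditions on such an object that the tree can state —
class information for whoever attacks the node from either side (no Theses decl is asserted):

* `cascadeCore_farField_veryWeakEuler` — **the far field is an Euler cone.** For ANY smooth steady
  unforced NS₁ solution `(Q, P)` on `ℝ³` (no Dirichlet or envelope hypothesis) and any measurable,
  locally-`L²`-off-the-origin, `(−2/3)`-DSS field `V` satisfying the shell clause, `V` is weakly
  divergence-free off the origin and a VERY WEAK steady Euler field off the origin: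
  `∫ ⟪V, Dφ·V⟫ = 0` for every divergence-free test field `φ` supported off `0`, and `∫ ⟪V, ∇θ⟫ = 0`.
  Mechanism: the blow-downs `Q_k = (λ^k)^{2/3} Q(λ^k ·)` solve unforced steady NS at viscosity
  `ν_k = (λ^k)^{-1/3} → 0` and converge to `V` in `L²` of every fixed annulus; quadratic pairings pass
  to the limit and the viscous term dies. Composition of four landed stubs of the sibling crux
  `SolitonTransplant` (stmt-19035: `stub_testedRescaledNS`, `stub_shellDefectScaling`,
  `stub_localL2Convergence`, `stub_farFieldWeakEuler`), restated for this crux's hypotheses. So a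
  cascade soliton's far field is itself a `PointFluxCone`-type datum minus the explicit pressure and
  the flux clause: the node re-enters the cone class it was meant to desingularise.
* `cascadeCore_annular_L3_floor` — **the far field charges every dyadic annulus in `L³`, by the
  dissipation.** There is a universal `δ > 0` such that every smooth steady unforced NS₁ solution on
  `ℝ³` with `0 < D = ∫|∇Q|² < ∞` has `δ · D < (liminf_{R→∞} R^{-1/3} ‖Q‖_{L³(R/2 ≤ |x| < R)})³`
  (in `ℝ≥0∞`). This is the contrapositive of the smallness clause of Seregin–Wang's annular
  criterion at the critical rate (Seregin–Wang 2020 Thm 1.1, `q = ℓ = 3`; Wang 2025 Thm 2.4 (i)),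
  which is PROVED in the tree (`sereginWang_liouville_L3_annulus_holds`). Reading: along every
  sequence `R → ∞`, eventually `∫_{R/2≤|x|<R} |Q|³ > δ D R` — the `L³` intensity of the far field on
  every large dyadic annulus is pinned from below at exactly the critical rate by the dissipation it
  must feed; no soliton is `L³`-quiet on a sequence of annuli (compare the `L²` shell floor
  `Negative.shell_mass_floor`, which carries no `D`).

References: Seregin–Wang, St. Petersburg Math. J. 31 (2020) 387–393 (arXiv:1805.02227), Thm 1.1;
W. Wang, *Liouville theorems for the steady Navier–Stokes equations* (Science Press 2025), Thm 2.4 (i);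
the blow-down/weak-Euler passage is folklore (vanishing viscosity with strong `L²_loc` convergence).
-/

noncomputable section

-- `Summit.<Summit>.<Problem>`: single-conjunct summit, the duplicate namespace is mandated (CONVENTIONS §2).
set_option linter.dupNamespace false

namespace Summit.AnomalousDissipation.AnomalousDissipation.Theorems

open MeasureTheory Filter Topology Set Metric
open scoped InnerProductSpace ContDiff Laplacian ENNReal NNReal
open Literature.Analysis.FunctionSpaces Literature.Analysis.FluidPDE

/-! ## The far field of a soliton is a very weak Euler cone off the origin -/

/-- **The far field is an Euler cone (very weak form).** Let `(Q, P)` be a smooth steady solution of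
the unforced unit-viscosity Navier–Stokes system on `ℝ³` (time-constant `IsClassicalNSSolutionOn univ`),
`λ > 1`, and `V` a measurable field, locally `L²` off the origin, discretely self-similar of degree
`−2/3`, with `(λ^k)^{-5/3} ∫_{λ^k<|x|<λ^{k+1}} |Q − V|² → 0`. Then `V` is a very weak steady Euler
field off the origin — `∫ ⟪V, Dφ·V⟫ = 0` for every divergence-free test field `φ` compactly supported
in `ℝ³ ∖ {0}` — and weakly divergence-free there, `∫ ⟪V, ∇θ⟫ = 0`. (Blow-down `Q_k = (λ^k)^{2/3}Q(λ^k·)`: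
unforced steady NS at viscosity `(λ^k)^{-1/3} → 0`, `Q_k → V` in `L²` of every annulus; composition of
the landed `stub_testedRescaledNS`, `stub_shellDefectScaling`, `stub_localL2Convergence`,
`stub_farFieldWeakEuler` of crux stmt-AnomalousDissipation-19035.) [folklore] -/
theorem cascadeCore_farField_veryWeakEuler (Q V : EuclideanSpace ℝ (Fin 3) → EuclideanSpace ℝ (Fin 3)) (P : EuclideanSpace ℝ (Fin 3) → ℝ) (lam : ℝ) (hlam : 1 < lam)
    (hNS : IsClassicalNSSolutionOn (univ : Set ℝ) 1 (fun _ _ => 0) (fun _ => Q) (fun _ => P))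
    (hV : AEStronglyMeasurable V volume)
    (hVss : ∀ x : EuclideanSpace ℝ (Fin 3), x ≠ 0 → V (lam • x) = lam ^ (-(2 / 3 : ℝ)) • V x)
    (hVloc : LocallyIntegrableOn (fun x => ‖V x‖ ^ 2) {x : EuclideanSpace ℝ (Fin 3) | x ≠ 0} volume)
    (hTend : Tendsto (fun k : ℕ => (lam ^ k) ^ (-(5 / 3 : ℝ)) *
      ∫ x in {x : EuclideanSpace ℝ (Fin 3) | lam ^ k < ‖x‖ ∧ ‖x‖ < lam ^ (k + 1)}, ‖Q x - V x‖ ^ 2) atTop (𝓝 0)) :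
    (∀ φ : EuclideanSpace ℝ (Fin 3) → EuclideanSpace ℝ (Fin 3), IsTestFunctionOn ⟨{x : EuclideanSpace ℝ (Fin 3) | x ≠ 0}, isOpen_ne⟩ φ →
        (∀ x, VectorCalculus.divergence φ x = 0) → ∫ x, ⟪V x, fderiv ℝ φ x (V x)⟫_ℝ = 0) ∧
      (∀ θ : EuclideanSpace ℝ (Fin 3) → ℝ, IsTestFunctionOn ⟨{x : EuclideanSpace ℝ (Fin 3) | x ≠ 0}, isOpen_ne⟩ θ →
        ∫ x, ⟪V x, gradient θ x⟫_ℝ = 0) := by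
  have hQ : Continuous Q := (hNS.contDiff_velocity (mem_univ (0 : ℝ))).continuous
  -- integer shells, then every annulus
  have hshellZ := stub_shellDefectScaling Q V lam hlam hVss hTend
  have hann := stub_localL2Convergence Q V lam hlam hQ hV hVloc hshellZ
  -- tested identities of the exact rescalings (the scale `λ^k > 0`)
  have htest : ∀ k : ℕ, _ := fun k => stub_testedRescaledNS Q P hNS (lam ^ k) (pow_pos (one_pos.trans hlam) k)
  exact stub_farFieldWeakEuler Q V lam hlam hQ hV hVloc hann (fun k => (htest k).1) (fun k => (htest k).2)

/-! ## The `L³` floor on dyadic annuli (Seregin–Wang, proved in the tree) -/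

/-- **Every soliton charges every large dyadic annulus in `L³`, by its dissipation.** There is a
universal `δ > 0` such that for every smooth steady solution `(Q, P)` of the unforced unit-viscosity
Navier–Stokes system on `ℝ³` with `0 < ∫|∇Q|² < ∞` (Frobenius Dirichlet integral, as in
`CascadeSoliton`), `δ · ∫|∇Q|² < (liminf_{R→∞} R^{-1/3}‖Q‖_{L³(R/2≤|x|<R)})³` in `ℝ≥0∞`
(`sereginWangL3`). Contrapositive of the smallness clause (2.14) of Seregin–Wang 2020, Thm 1.1
(`q = ℓ = 3`; Wang 2025, Thm 2.4 (i)), discharged in the tree as `sereginWang_liouville_L3_annulus_holds`: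
if the cube of the `lim inf` were `≤ δ D` the solution would vanish, contradicting `0 < D`.
[cite: SereginWang2020, Thm 1.1] -/
theorem cascadeCore_annular_L3_floor : ∃ δ : ℝ≥0, 0 < δ ∧
    ∀ (Q : EuclideanSpace ℝ (Fin 3) → EuclideanSpace ℝ (Fin 3)) (P : EuclideanSpace ℝ (Fin 3) → ℝ),
      IsClassicalNSSolutionOn (univ : Set ℝ) 1 (fun _ _ => 0) (fun _ => Q) (fun _ => P) →
      Integrable (fun x => frobeniusNormSq (fderiv ℝ Q x)) →
      0 < ∫ x, frobeniusNormSq (fderiv ℝ Q x) →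
      (δ : ℝ≥0∞) * ENNReal.ofReal (∫ x, frobeniusNormSq (fderiv ℝ Q x)) <
        (liminf (sereginWangL3 Q) atTop) ^ 3 := by
  obtain ⟨c, δ, hδ, H⟩ := sereginWang_liouville_L3_annulus_holds
  refine ⟨δ, hδ, fun Q P hNS hInt hpos => ?_⟩
  have hprof : IsLerayProfile 1 0 Q P := hNS.isLerayProfile_zero_of_steady
  have hQs : ContDiff ℝ (⊤ : ℕ∞) Q := hNS.contDiff_velocity (mem_univ (0 : ℝ))
  have hPs : ContDiff ℝ (⊤ : ℕ∞) P := hNS.contDiff_pressure (mem_univ (0 : ℝ))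
  -- the Frobenius Dirichlet integral as a lintegral
  have hlin : ∫⁻ x, ENNReal.ofReal (frobeniusNormSq (fderiv ℝ Q x)) =
      ENNReal.ofReal (∫ x, frobeniusNormSq (fderiv ℝ Q x)) :=
    (ofReal_integral_eq_lintegral_ofReal hInt (Eventually.of_forall fun x => frobeniusNormSq_nonneg _)).symm
  by_cases hL : liminf (sereginWangL3 Q) atTop < (⊤ : ℝ≥0∞)
  · obtain ⟨-, hsmall⟩ := H Q P hprof hQs hPs hL
    by_contra hle
    push Not at hle
    have hQ0 : Q = 0 := hsmall (by rw [hlin]; exact hle)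
    subst hQ0
    simp [frobeniusNormSq_zero] at hpos
  · push Not at hL
    have htop : liminf (sereginWangL3 Q) atTop = (⊤ : ℝ≥0∞) := top_le_iff.1 hL
    rw [htop, ENNReal.top_pow (by norm_num)]
    exact ENNReal.mul_lt_top ENNReal.coe_lt_top ENNReal.ofReal_lt_top

/-! ## Registered tools stub -/

/-- **Registered tools stub `stub_coneDesingularisationNodeClassTools`** (line `Sketch`, lead cycle 2;
`ledger workitem stub-add stmt-AnomalousDissipation-19034 --name stub_coneDesingularisationNodeClassTools`):
the conjunction of the two necessary conditions on the node class proved above — the far field of an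
entire steady NS₁ solution with the shell clause is a very weak Euler cone, weakly divergence-free, off
the origin; and the Seregin–Wang `L³` floor on dyadic annuli by the dissipation. [folklore] -/
theorem stub_coneDesingularisationNodeClassTools :
    (∀ (Q V : EuclideanSpace ℝ (Fin 3) → EuclideanSpace ℝ (Fin 3)) (P : EuclideanSpace ℝ (Fin 3) → ℝ) (lam : ℝ), 1 < lam → Literature.Analysis.FluidPDE.IsClassicalNSSolutionOn Set.univ 1 (fun _ _ => 0) (fun _ => Q) (fun _ => P) → MeasureTheory.AEStronglyMeasurable V MeasureTheory.volume → (∀ x : EuclideanSpace ℝ (Fin 3), x ≠ 0 → V (lam • x) = lam ^ (-(2 / 3 : ℝ)) • V x) → MeasureTheory.LocallyIntegrableOn (fun x => ‖V x‖ ^ 2) {x : EuclideanSpace ℝ (Fin 3) | x ≠ 0} MeasureTheory.volume → Filter.Tendsto (fun k : ℕ => (lam ^ k) ^ (-(5 / 3 : ℝ)) * ∫ x in {x : EuclideanSpace ℝ (Fin 3) | lam ^ k < ‖x‖ ∧ ‖x‖ < lam ^ (k + 1)}, ‖Q x - V x‖ ^ 2) Filter.atTop (nhds 0) → (∀ φ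 : EuclideanSpace ℝ (Fin 3) → EuclideanSpace ℝ (Fin 3), Literature.Analysis.FunctionSpaces.IsTestFunctionOn ⟨{x : EuclideanSpace ℝ (Fin 3) | x ≠ 0}, isOpen_ne⟩ φ → (∀ x, Literature.Analysis.FluidPDE.VectorCalculus.divergence φ x = 0) → ∫ x, inner ℝ (V x) (fderiv ℝ φ x (V x)) = 0) ∧ (∀ θ : EuclideanSpace ℝ (Fin 3) → ℝ, Literature.Analysis.FunctionSpaces.IsTestFunctionOn ⟨{x : EuclideanSpace ℝ (Fin 3) | x ≠ 0}, isOpen_ne⟩ θ → ∫ x, inner ℝ (V x) (gradient θ x) = 0)) ∧ (∃ δ : NNReal, 0 < δ ∧ ∀ (Q : EuclideanSpace ℝ (Fin 3) → EuclideanSpace ℝ (Fin 3)) (P : EuclideanSpace ℝ (Fin 3) → ℝ), Literature.Analysis.FluidPDE.IsClassicalNSSolutionOn Set.univ 1 (fun _ _ => 0) (fun _ => Q) (fun _ => P) → MeasureTheory.Integrable (fun x => Literature.Analysis.FluidPDE.frobeniusNormSq (fderiv ℝ Q x)) → 0 < ∫ x, Literature.Analysis.FluidPDE.frobeniusNormSq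 (fderiv ℝ Q x) → (δ : ENNReal) * ENNReal.ofReal (∫ x, Literature.Analysis.FluidPDE.frobeniusNormSq (fderiv ℝ Q x)) < (Filter.liminf (Literature.Analysis.FluidPDE.sereginWangL3 Q) Filter.atTop) ^ 3) :=
  ⟨fun Q V P lam hlam hNS hV hVss hVloc hTend =>
      cascadeCore_farField_veryWeakEuler Q V P lam hlam hNS hV hVss hVloc hTend,
    cascadeCore_annular_L3_floor⟩

end Summit.AnomalousDissipation.AnomalousDissipation.Theorems

end
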